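import Mathlib
import Summits.NavierStokesRegularity.NavierStokesRegularity.Theorems.EulerZoomLiouvillePowerGaugeEulerLiouvilleBallTentWeights
import HarnessLib

/-!
# R49 plate t52-MV, part 2: the MEAN-VALUE FORMULA (tent form) from a radial virial identity
# (nsreg-p2 ROUND-49 «EVERY BALL BREATHES», `NsregP2.R49.MeanValueFormula`, text `r49/Sketch49.lean` l.84–91; seat ns-sfl-p1 g8,
# `--supports stmt-NavierStokesRegularity-19832 --as helper`)

`meanValueFormula_of_radialVirial`: if continuous `V`, `P` satisfy the radial virial identity
`∫ ψ(‖z‖²)‖V‖² + 2ψ′(‖z‖²)⟪V,z⟫² + P(3ψ(‖z‖²) + 2‖z‖²ψ′(‖z‖²)) = 0` for every `ψ ∈ C¹_c(ℝ)` about the centre `x₀` (`z = y − x₀`;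
for `γ`-profiles this is ns-ezl-w2 g5's `ClassicalProfile.radialVirialIdentity`, t52-RV), then for every `δ > 0`
`∫_{B_δ(x₀)} (⟪V,z⟫²/‖z‖ + ‖z‖·P) dy = ∫_{B_δ(x₀)} (δ − ‖z‖)(‖V‖² + 3P) dy` — Chae–Wolf 2016 (2.1), tent form.
Proof: test with the tent weights `ψ_k(s) = g_k(√|s|)` of `…BallTentWeights`; along `s = ‖z‖²` the integrand is
`g_k(‖z‖)‖V‖² − χ_k(‖z‖)⟪V,z⟫²/‖z‖ + P(3g_k(‖z‖) − ‖z‖χ_k(‖z‖))`, dominated by `(2δ‖V‖² + 4δ|P|)·1_{B̄_δ(x₀)}` and converging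
EVERYWHERE to `1_{B_δ(x₀)}[(δ − ‖z‖)‖V‖² − ⟪V,z⟫²/‖z‖ + P(3(δ − ‖z‖) − ‖z‖)]`; dominated convergence, then split the ball integral.
The VERBATIM `MeanValueFormula γ` for profiles is the 5-line corollary with `radialVirialIdentity` (sequel, once t52-RV is in the tree).

HONEST FRAMING: an instrument identity of ROUND-49 (class-free); nothing about the crux E (19832 OPEN) or NS regularity is proved
here. [cite: ChaeWolf2016, Lemma 2.1 (2.1)] [folklore]
-/

noncomputable section

set_option linter.dupNamespace false

open MeasureTheory Set Filter Topology Metric Function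
open scoped RealInnerProductSpace Topology

namespace Summit.NavierStokesRegularity.NavierStokesRegularity.Theorems.PowerGaugeEulerLiouville

open Literature.Analysis Literature.Analysis.FluidPDE

namespace ClassicalProfile

/-! ## §4 The mean-value formula -/

/-- `⟪v, z⟫²/‖z‖ ≤ ‖v‖²·‖z‖` (Cauchy–Schwarz; both sides vanish at `z = 0`). [folklore] -/
theorem inner_sq_div_norm_le (v z : EuclideanSpace ℝ (Fin 3)) : ⟪v, z⟫ ^ 2 / ‖z‖ ≤ ‖v‖ ^ 2 * ‖z‖ := by
  by_cases hz : z = 0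
  · simp [hz]
  · rw [div_le_iff₀ (norm_pos_iff.2 hz)]
    have h := abs_real_inner_le_norm v z
    have h0 : 0 ≤ |⟪v, z⟫| := abs_nonneg _
    nlinarith [sq_abs ⟪v, z⟫, norm_nonneg v, norm_nonneg z, mul_nonneg (norm_nonneg v) (norm_nonneg z)]

/-- **THE MEAN-VALUE FORMULA from a radial virial identity** (the analytic content of t52-MV): if continuous `V`, `P` satisfy
`∫ ψ(‖z‖²)‖V‖² + 2ψ′(‖z‖²)⟪V,z⟫² + P(3ψ(‖z‖²) + 2‖z‖²ψ′(‖z‖²)) = 0` for every `C¹_c` weight `ψ` about the centre `x₀`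
(`z = y − x₀`), then for every `δ > 0`
`∫_{B_δ(x₀)} (⟪V,z⟫²/‖z‖ + ‖z‖P) = ∫_{B_δ(x₀)} (δ − ‖z‖)(‖V‖² + 3P)` (tent weights `ψ_k(s) = g_k(√|s|)` + dominated convergence).
[cite: ChaeWolf2016, Lemma 2.1 (2.1)] [folklore] -/
theorem meanValueFormula_of_radialVirial {V : EuclideanSpace ℝ (Fin 3) → EuclideanSpace ℝ (Fin 3)}
    {P : EuclideanSpace ℝ (Fin 3) → ℝ} (hV : Continuous V) (hP : Continuous P) (x₀ : EuclideanSpace ℝ (Fin 3))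
    (hRV : ∀ ψ : ℝ → ℝ, ContDiff ℝ 1 ψ → HasCompactSupport ψ →
      ∫ y, (ψ (‖y - x₀‖ ^ 2) * ‖V y‖ ^ 2 + 2 * deriv ψ (‖y - x₀‖ ^ 2) * ⟪V y, y - x₀⟫ ^ 2
        + P y * (3 * ψ (‖y - x₀‖ ^ 2) + 2 * ‖y - x₀‖ ^ 2 * deriv ψ (‖y - x₀‖ ^ 2))) = 0)
    {δ : ℝ} (hδ : 0 < δ) :
    ∫ y in ball x₀ δ, (⟪V y, y - x₀⟫ ^ 2 / ‖y - x₀‖ + ‖y - x₀‖ * P y)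
      = ∫ y in ball x₀ δ, (δ - ‖y - x₀‖) * (‖V y‖ ^ 2 + 3 * P y) := by
  -- the cutoffs `χ k`, the tent weights `g k`
  set χ : ℕ → ℝ → ℝ := fun k t =>
    Real.smoothTransition (((k : ℝ) + 1) * t - 1) * Real.smoothTransition (((k : ℝ) + 1) * (δ - t)) with hχ
  set g : ℕ → ℝ → ℝ := fun k t => ∫ r in t..δ, χ k r with hg
  -- the regularised integrands `G k` and their limit `G∞`
  set G : ℕ → EuclideanSpace ℝ (Fin 3) → ℝ := fun k y =>
    g k ‖y - x₀‖ * ‖V y‖ ^ 2 - χ k ‖y - x₀‖ * (⟪V y, y - x₀⟫ ^ 2 / ‖y - x₀‖)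
      + P y * (3 * g k ‖y - x₀‖ - ‖y - x₀‖ * χ k ‖y - x₀‖) with hG
  set Ginf : EuclideanSpace ℝ (Fin 3) → ℝ := (ball x₀ δ).indicator fun y =>
    (δ - ‖y - x₀‖) * ‖V y‖ ^ 2 - ⟪V y, y - x₀⟫ ^ 2 / ‖y - x₀‖ + P y * (3 * (δ - ‖y - x₀‖) - ‖y - x₀‖) with hGinf
  -- (1) the radial virial identity with the weight `ψ_k` IS `∫ G k = 0`
  have hGk : ∀ k : ℕ, ∫ y, G k y = 0 := by
    intro k
    have h := hRV (fun s => g k (Real.sqrt |s|)) (contDiff_tentRadial k δ) (hasCompactSupport_tentRadial k δ)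
    rw [← h]
    refine integral_congr_ae (Eventually.of_forall fun y => ?_)
    by_cases hz : y - x₀ = 0
    · simp [hG, hz]
    · have hd := deriv_tentRadial_normSq k δ hz
      have hn : g k (Real.sqrt |‖y - x₀‖ ^ 2|) = g k ‖y - x₀‖ := by
        rw [abs_of_nonneg (sq_nonneg _), Real.sqrt_sq (norm_nonneg _)]
      simp only [hG]
      rw [hd, hn]
      have hz' : ‖y - x₀‖ ≠ 0 := norm_ne_zero_iff.2 hz
      simp only [hχ]
      field_simp
      ring
  -- (2) domination `|G k| ≤ (2δ‖V‖² + 4δ|P|)·1_{B̄_δ(x₀)}`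
  have hbound : ∀ k y, ‖G k y‖ ≤ (closedBall x₀ δ).indicator (fun y => 2 * δ * ‖V y‖ ^ 2 + 4 * δ * |P y|) y := by
    intro k y
    have ht0 : 0 ≤ ‖y - x₀‖ := norm_nonneg _
    have hcs := inner_sq_div_norm_le (V y) (y - x₀)
    have hχI := tentCutoff_mem_Icc k δ ‖y - x₀‖
    by_cases hyδ : ‖y - x₀‖ ≤ δ
    · have hmem : y ∈ closedBall x₀ δ := by rwa [mem_closedBall, dist_eq_norm]
      rw [indicator_of_mem hmem, Real.norm_eq_abs]
      have hgI := tentWeight_mem_Icc k (δ := δ) (t := ‖y - x₀‖) ⟨ht0, hyδ⟩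
      have hA : |g k ‖y - x₀‖ * ‖V y‖ ^ 2| ≤ δ * ‖V y‖ ^ 2 := by
        rw [abs_of_nonneg (mul_nonneg hgI.1 (sq_nonneg _))]
        exact mul_le_mul_of_nonneg_right (hgI.2.trans (by linarith)) (sq_nonneg _)
      have hB : |χ k ‖y - x₀‖ * (⟪V y, y - x₀⟫ ^ 2 / ‖y - x₀‖)| ≤ δ * ‖V y‖ ^ 2 := by
        rw [abs_of_nonneg (mul_nonneg hχI.1 (div_nonneg (sq_nonneg _) ht0))]
        calc χ k ‖y - x₀‖ * (⟪V y, y - x₀⟫ ^ 2 / ‖y - x₀‖) ≤ 1 * (‖V y‖ ^ 2 * ‖y - x₀‖) :=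
              mul_le_mul hχI.2 hcs (div_nonneg (sq_nonneg _) ht0) zero_le_one
          _ ≤ δ * ‖V y‖ ^ 2 := by rw [one_mul, mul_comm]; exact mul_le_mul_of_nonneg_right hyδ (sq_nonneg _)
      have hC : |P y * (3 * g k ‖y - x₀‖ - ‖y - x₀‖ * χ k ‖y - x₀‖)| ≤ 4 * δ * |P y| := by
        rw [abs_mul]
        have h1 : |3 * g k ‖y - x₀‖ - ‖y - x₀‖ * χ k ‖y - x₀‖| ≤ 4 * δ := by
          refine abs_le.2 ⟨?_, ?_⟩
          · nlinarith [hgI.1, hχI.2, mul_le_mul_of_nonneg_right hyδ hχI.1]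
          · nlinarith [hgI.2, hχI.1, mul_nonneg ht0 hχI.1]
        calc |P y| * |3 * g k ‖y - x₀‖ - ‖y - x₀‖ * χ k ‖y - x₀‖| ≤ |P y| * (4 * δ) :=
              mul_le_mul_of_nonneg_left h1 (abs_nonneg _)
          _ = 4 * δ * |P y| := by ring
      calc |G k y| = |g k ‖y - x₀‖ * ‖V y‖ ^ 2 - χ k ‖y - x₀‖ * (⟪V y, y - x₀⟫ ^ 2 / ‖y - x₀‖)
              + P y * (3 * g k ‖y - x₀‖ - ‖y - x₀‖ * χ k ‖y - x₀‖)| := by rw [hG]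
        _ ≤ |g k ‖y - x₀‖ * ‖V y‖ ^ 2 - χ k ‖y - x₀‖ * (⟪V y, y - x₀⟫ ^ 2 / ‖y - x₀‖)|
              + |P y * (3 * g k ‖y - x₀‖ - ‖y - x₀‖ * χ k ‖y - x₀‖)| := abs_add_le _ _
        _ ≤ (|g k ‖y - x₀‖ * ‖V y‖ ^ 2| + |χ k ‖y - x₀‖ * (⟪V y, y - x₀⟫ ^ 2 / ‖y - x₀‖)|)
              + |P y * (3 * g k ‖y - x₀‖ - ‖y - x₀‖ * χ k ‖y - x₀‖)| := by
            gcongr; exact abs_sub _ _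
        _ ≤ (δ * ‖V y‖ ^ 2 + δ * ‖V y‖ ^ 2) + 4 * δ * |P y| := by gcongr
        _ = 2 * δ * ‖V y‖ ^ 2 + 4 * δ * |P y| := by ring
    · have hlt : δ < ‖y - x₀‖ := lt_of_not_ge hyδ
      have hg0 : g k ‖y - x₀‖ = 0 := tentWeight_eq_zero_of_le k hlt.le
      have hχ0 : χ k ‖y - x₀‖ = 0 := tentCutoff_eq_zero_of_le k hlt.le
      have hnot : y ∉ closedBall x₀ δ := by rw [mem_closedBall, dist_eq_norm]; exact hyδ
      rw [indicator_of_notMem hnot]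
      simp [hG, hg0, hχ0]
  -- (3) pointwise convergence `G k → G∞` everywhere
  have hlim : ∀ y, Tendsto (fun k => G k y) atTop (𝓝 (Ginf y)) := by
    intro y
    have ht0 : 0 ≤ ‖y - x₀‖ := norm_nonneg _
    by_cases hyδ : ‖y - x₀‖ < δ
    · have hmem : y ∈ ball x₀ δ := by rwa [mem_ball, dist_eq_norm]
      rw [hGinf, indicator_of_mem hmem]
      have hgt : Tendsto (fun k => g k ‖y - x₀‖) atTop (𝓝 (δ - ‖y - x₀‖)) := tendsto_tentWeight ⟨ht0, hyδ.le⟩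
      by_cases hz : y - x₀ = 0
      · -- at the centre the `χ`-terms vanish identically
        have e : (fun k => G k y) = fun k => g k ‖y - x₀‖ * ‖V y‖ ^ 2 + P y * (3 * g k ‖y - x₀‖) := by
          funext k; simp [hG, hz]
        rw [e]
        have hzn : ‖y - x₀‖ = 0 := by rw [hz, norm_zero]
        simp only [hzn, sub_zero, div_zero] at hgt ⊢
        exact (hgt.mul_const _).add (tendsto_const_nhds.mul (hgt.const_mul _))
      · have hpos : 0 < ‖y - x₀‖ := norm_pos_iff.2 hz
        have hχt : Tendsto (fun k => χ k ‖y - x₀‖) atTop (𝓝 1) := tendsto_tentCutoff hpos hyδ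
        have h := ((hgt.mul_const (‖V y‖ ^ 2)).sub (hχt.mul_const (⟪V y, y - x₀⟫ ^ 2 / ‖y - x₀‖))).add
          (tendsto_const_nhds.mul ((hgt.const_mul 3).sub (tendsto_const_nhds.mul hχt))
            (f := fun _ : ℕ => P y) (g := fun k => 3 * g k ‖y - x₀‖ - ‖y - x₀‖ * χ k ‖y - x₀‖))
        simp only [one_mul, mul_one] at h
        exact h
    · have hle : δ ≤ ‖y - x₀‖ := le_of_not_gt hyδ
      have hnot : y ∉ ball x₀ δ := by rw [mem_ball, dist_eq_norm]; exact hyδ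
      rw [hGinf, indicator_of_notMem hnot]
      have e : (fun k => G k y) = fun _ => 0 := by
        funext k
        simp [hG, tentWeight_eq_zero_of_le k hle, tentCutoff_eq_zero_of_le k hle, hχ, hg]
      rw [e]
      exact tendsto_const_nhds
  -- (4) dominated convergence: `∫ G∞ = lim ∫ G k = 0`
  have hcont_norm : Continuous fun y : EuclideanSpace ℝ (Fin 3) => ‖y - x₀‖ := continuous_norm.comp (continuous_sub_right x₀)
  have hcont_inner : Continuous fun y : EuclideanSpace ℝ (Fin 3) => ⟪V y, y - x₀⟫ :=
    hV.inner (continuous_id.sub continuous_const)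
  have hGmeas : ∀ k, AEStronglyMeasurable (G k) volume := by
    intro k
    have h1 : Measurable fun y => g k ‖y - x₀‖ := (continuous_tentWeight k δ).measurable.comp hcont_norm.measurable
    have h2 : Measurable fun y => χ k ‖y - x₀‖ := (continuous_tentCutoff k δ).measurable.comp hcont_norm.measurable
    have h3 : Measurable fun y : EuclideanSpace ℝ (Fin 3) => ⟪V y, y - x₀⟫ ^ 2 / ‖y - x₀‖ :=
      (hcont_inner.measurable.pow_const 2).div hcont_norm.measurable
    exact (((h1.mul (hV.measurable.norm.pow_const 2)).sub (h2.mul h3)).add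
      (hP.measurable.mul ((h1.const_mul 3).sub (hcont_norm.measurable.mul h2)))).aestronglyMeasurable
  have hboundI : Integrable ((closedBall x₀ δ).indicator fun y => 2 * δ * ‖V y‖ ^ 2 + 4 * δ * |P y|) volume := by
    refine IntegrableOn.integrable_indicator ?_ measurableSet_closedBall
    have hc : Continuous fun y => 2 * δ * ‖V y‖ ^ 2 + 4 * δ * |P y| := by fun_prop
    exact hc.continuousOn.integrableOn_compact (isCompact_closedBall x₀ δ)
  have hDCT := tendsto_integral_of_dominated_convergence
    ((closedBall x₀ δ).indicator fun y => 2 * δ * ‖V y‖ ^ 2 + 4 * δ * |P y|) hGmeas hboundI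
    (fun k => Eventually.of_forall (hbound k)) (Eventually.of_forall hlim)
  have hzero : ∫ y, Ginf y = 0 := by
    have hconst : Tendsto (fun k : ℕ => ∫ y, G k y) atTop (𝓝 0) := by
      simp only [hGk]; exact tendsto_const_nhds
    exact tendsto_nhds_unique hDCT hconst
  -- (5) unpack `∫ G∞ = ∫_{B_δ} f₁ − ∫_{B_δ} f₂`
  rw [hGinf, integral_indicator measurableSet_ball] at hzero
  have hK : IsCompact (closedBall x₀ δ) := isCompact_closedBall x₀ δ
  have hf₁ : IntegrableOn (fun y => (δ - ‖y - x₀‖) * (‖V y‖ ^ 2 + 3 * P y)) (ball x₀ δ) volume := by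
    have hc : Continuous fun y => (δ - ‖y - x₀‖) * (‖V y‖ ^ 2 + 3 * P y) := by fun_prop
    exact (hc.continuousOn.integrableOn_compact hK).mono_set ball_subset_closedBall
  have hf₂ : IntegrableOn (fun y => ⟪V y, y - x₀⟫ ^ 2 / ‖y - x₀‖ + ‖y - x₀‖ * P y) (ball x₀ δ) volume := by
    have hc : Continuous fun y => ‖V y‖ ^ 2 * ‖y - x₀‖ + ‖y - x₀‖ * |P y| := by fun_prop
    refine Integrable.mono' ((hc.continuousOn.integrableOn_compact hK).mono_set ball_subset_closedBall)
      ((((hcont_inner.measurable.pow_const 2).div hcont_norm.measurable).add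
        (hcont_norm.measurable.mul hP.measurable)).aestronglyMeasurable) (ae_of_all _ fun y => ?_)
    rw [Real.norm_eq_abs]
    calc |⟪V y, y - x₀⟫ ^ 2 / ‖y - x₀‖ + ‖y - x₀‖ * P y|
        ≤ |⟪V y, y - x₀⟫ ^ 2 / ‖y - x₀‖| + |‖y - x₀‖ * P y| := abs_add_le _ _
      _ ≤ ‖V y‖ ^ 2 * ‖y - x₀‖ + ‖y - x₀‖ * |P y| := by
          rw [abs_of_nonneg (div_nonneg (sq_nonneg _) (norm_nonneg _)), abs_mul, abs_of_nonneg (norm_nonneg _)]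
          gcongr
          exact inner_sq_div_norm_le (V y) (y - x₀)
  have hsplit : ∫ y in ball x₀ δ, ((δ - ‖y - x₀‖) * ‖V y‖ ^ 2 - ⟪V y, y - x₀⟫ ^ 2 / ‖y - x₀‖
      + P y * (3 * (δ - ‖y - x₀‖) - ‖y - x₀‖)) =
      (∫ y in ball x₀ δ, (δ - ‖y - x₀‖) * (‖V y‖ ^ 2 + 3 * P y))
        - ∫ y in ball x₀ δ, (⟪V y, y - x₀⟫ ^ 2 / ‖y - x₀‖ + ‖y - x₀‖ * P y) := by
    rw [← integral_sub hf₁ hf₂]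
    refine integral_congr_ae (Eventually.of_forall fun y => ?_)
    ring
  rw [hsplit] at hzero
  linarith

end ClassicalProfile

end Summit.NavierStokesRegularity.NavierStokesRegularity.Theorems.PowerGaugeEulerLiouville

end
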